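import Summits.AnomalousDissipation.AnomalousDissipation.Theorems.SolenoidalFractalHomogenisationLagrangianStepLabelSplit
import HarnessLib

/-!
# K1L_D (stmt-AnomalousDissipation-27980), stub `stub_windowFactsH`: the operator fact (Hi) from the band kill of the coarse map (W3-E (ii))
# (helper; `--supports … --as helper`; lead-k1l-onelevel-p1 g3)

(Hi) of the window facts says: the coarse window map `T` neither transmits (`‖T (Q y)‖ ≤ ε‖y‖`), nor produces (`‖Q (T y)‖ ≤ ε‖y‖`), nor adjointly
transmits (`‖T† (Q y)‖ ≤ ε‖y‖`) the high-label class `Q`.  This file derives the three bounds, with `ε := e₁ + e₂`, from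
* the BAND-KILL bounds of W3-E §4c (v25, propagator form, NORM form): output form for `T`
  `‖T y − P_L (T y)‖ ≤ e₁ ‖y − P_{L'} y‖ + e₂ ‖y‖` and input form for `T` and for `T†` `P_L y = 0 ⇒ ‖T y‖ ≤ (e₁ + e₂) ‖y‖` (`P_L = cutLp L`), and
* a projector `Q` of `V2` whose range has NO frequencies in the ball of radius `L`: Fourier characterisation `𝓕(Q y)(k) = 1_C(k) 𝓕(y)(k)` with
  `C ⊆ {k | L² < |k|²}` (the W0 projectors of `…LabelSplit` for a label class `> Lc/2 ≥ L`; labels are `≤` frequencies).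
Two Fourier facts about such `Q` are proved first: `cutLp L (Q y) = 0` and `‖Q z‖ ≤ ‖z − cutLp L z‖`.  Pure Hilbert/Fourier bookkeeping on `V2`.
NOT a proof of the stub, of the crux, or of AD; rung F-D1.A0.
-/

set_option linter.dupNamespace false

noncomputable section

namespace Summit.AnomalousDissipation.AnomalousDissipation.Theorems.SolenoidalFractalHomogenisation.LagrangianStep

open Literature.Analysis Literature.Analysis.FunctionSpaces
open MeasureTheory Set Filter UnitAddTorus
open scoped ENNReal NNReal InnerProductSpace Classical
open OneLevelSplit

/-! ## Fourier facts about `cutLp` and a far-supported projector -/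

/-- Coefficients of the cut: `𝓕(cutLp L y)(k) = 1_{|k| ≤ L} 𝓕(y)(k)`. -/
theorem fcoeff_cutLp (L : ℕ) (y : V2) (k : Fin 3 → ℤ) :
    mFourierCoeff (EuclideanSpace.complexify ∘ ⇑(cutLp L y)) k
      = if k ∈ Torus.freqBall L then mFourierCoeff (EuclideanSpace.complexify ∘ ⇑y) k else 0 := by
  have hae : (EuclideanSpace.complexify ∘ ⇑(cutLp L y)) =ᵐ[volume] (EuclideanSpace.complexify ∘ Torus.fourierTruncate L (y : VF)) := by
    filter_upwards [coeFn_cutLp L y] with x hx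
    simp only [Function.comp_apply, hx]
  rw [Torus.mFourierCoeff_congr_ae hae k]
  exact Torus.mFourierCoeff_fourierTruncate (integrable_coe_V2 y) L k

/-- A projector onto a class with no frequencies in the ball of radius `L` has `cutLp L ∘ Q = 0`. -/
theorem cutLp_proj_eq_zero {C : Set (Fin 3 → ℤ)} {L : ℕ} (hC : ∀ k ∈ C, ((L : ℝ)) ^ 2 < Torus.freqNormSq k)
    {Q : V2 →L[ℝ] V2}
    (hQ : ∀ (y : V2) (k : Fin 3 → ℤ), mFourierCoeff (EuclideanSpace.complexify ∘ ⇑(Q y)) k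
        = if k ∈ C then mFourierCoeff (EuclideanSpace.complexify ∘ ⇑y) k else 0)
    (y : V2) : cutLp L (Q y) = 0 := by
  have h0 : ∀ k, mFourierCoeff (EuclideanSpace.complexify ∘ ⇑(0 : V2)) k = 0 := by
    intro k
    have hae : (EuclideanSpace.complexify ∘ ⇑(0 : V2)) =ᵐ[volume] (fun _ => (0 : EuclideanSpace ℂ (Fin 3))) := by
      filter_upwards [Lp.coeFn_zero (EuclideanSpace ℝ (Fin 3)) 2 volume] with x hx
      simp only [Function.comp_apply, hx, Pi.zero_apply, map_zero]
    rw [Torus.mFourierCoeff_congr_ae hae k]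
    simp [mFourierCoeff]
  refine eq_of_fcoeff_eq fun k => ?_
  rw [h0, fcoeff_cutLp, hQ]
  by_cases hk : k ∈ Torus.freqBall L
  · rw [if_pos hk]
    by_cases hkC : k ∈ C
    · exact absurd (Torus.mem_freqBall.1 hk) (not_le.2 (hC k hkC))
    · rw [if_neg hkC]
  · rw [if_neg hk]

/-- A projector onto a class with no frequencies in the ball of radius `L` is dominated by the high-frequency cut: `‖Q z‖ ≤ ‖z − cutLp L z‖`. -/
theorem norm_proj_le_norm_sub_cutLp {C : Set (Fin 3 → ℤ)} {L : ℕ} (hC : ∀ k ∈ C, ((L : ℝ)) ^ 2 < Torus.freqNormSq k)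
    {Q : V2 →L[ℝ] V2}
    (hQ : ∀ (y : V2) (k : Fin 3 → ℤ), mFourierCoeff (EuclideanSpace.complexify ∘ ⇑(Q y)) k
        = if k ∈ C then mFourierCoeff (EuclideanSpace.complexify ∘ ⇑y) k else 0)
    (z : V2) : ‖Q z‖ ≤ ‖z - cutLp L z‖ := by
  have h1 := hasSum_norm_sq_fcoeff (Q z)
  have h2 := hasSum_norm_sq_fcoeff (z - cutLp L z)
  have hle : ‖Q z‖ ^ 2 ≤ ‖z - cutLp L z‖ ^ 2 := by
    refine hasSum_le (fun k => ?_) h1 h2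
    rw [hQ, fcoeff_sub, fcoeff_cutLp]
    by_cases hkC : k ∈ C
    · have hk : k ∉ Torus.freqBall L := Torus.not_mem_freqBall.2 (hC k hkC)
      rw [if_pos hkC, if_neg hk, sub_zero]
    · rw [if_neg hkC, norm_zero, zero_pow two_ne_zero]; positivity
  have := Real.sqrt_le_sqrt hle
  rwa [Real.sqrt_sq (norm_nonneg _), Real.sqrt_sq (norm_nonneg _)] at this

/-- Such a projector is a contraction: `‖Q z‖ ≤ ‖z‖`. -/
theorem norm_proj_le {C : Set (Fin 3 → ℤ)} {Q : V2 →L[ℝ] V2}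
    (hQ : ∀ (y : V2) (k : Fin 3 → ℤ), mFourierCoeff (EuclideanSpace.complexify ∘ ⇑(Q y)) k
        = if k ∈ C then mFourierCoeff (EuclideanSpace.complexify ∘ ⇑y) k else 0)
    (z : V2) : ‖Q z‖ ≤ ‖z‖ := by
  have h1 := hasSum_norm_sq_fcoeff (Q z)
  have h2 := hasSum_norm_sq_fcoeff z
  have hle : ‖Q z‖ ^ 2 ≤ ‖z‖ ^ 2 := by
    refine hasSum_le (fun k => ?_) h1 h2
    rw [hQ]
    split_ifs
    · exact le_rfl
    · rw [norm_zero, zero_pow two_ne_zero]; positivity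
  have := Real.sqrt_le_sqrt hle
  rwa [Real.sqrt_sq (norm_nonneg _), Real.sqrt_sq (norm_nonneg _)] at this

/-! ## (Hi) from the band kill -/

/-- **(Hi) from the band kill.**  `T` a map of `V2` with the output band-kill bound (levels `L' , L`) and the input band-kill bound at level `L` for
itself and for its adjoint; `Q` a projector onto a frequency class beyond the ball of radius `L`.  Then
`‖T (Q y)‖ ≤ (e₁ + e₂)‖y‖`, `‖Q (T y)‖ ≤ (e₁ + e₂)‖y‖`, `‖T† (Q y)‖ ≤ (e₁ + e₂)‖y‖`. -/
theorem hi_of_bandKill {C : Set (Fin 3 → ℤ)} {L' L : ℕ} (hC : ∀ k ∈ C, ((L : ℝ)) ^ 2 < Torus.freqNormSq k)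
    {Q : V2 →L[ℝ] V2}
    (hQ : ∀ (y : V2) (k : Fin 3 → ℤ), mFourierCoeff (EuclideanSpace.complexify ∘ ⇑(Q y)) k
        = if k ∈ C then mFourierCoeff (EuclideanSpace.complexify ∘ ⇑y) k else 0)
    (T : V2 →L[ℝ] V2) {e₁ e₂ : ℝ} (he₁ : 0 ≤ e₁) (he₂ : 0 ≤ e₂)
    (hout : ∀ y : V2, ‖T y - cutLp L (T y)‖ ≤ e₁ * ‖y - cutLp L' y‖ + e₂ * ‖y‖)
    (hin : ∀ y : V2, cutLp L y = 0 → ‖T y‖ ≤ (e₁ + e₂) * ‖y‖)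
    (hinAdj : ∀ y : V2, cutLp L y = 0 → ‖ContinuousLinearMap.adjoint T y‖ ≤ (e₁ + e₂) * ‖y‖) (y : V2) :
    ‖T (Q y)‖ ≤ (e₁ + e₂) * ‖y‖ ∧ ‖Q (T y)‖ ≤ (e₁ + e₂) * ‖y‖ ∧ ‖ContinuousLinearMap.adjoint T (Q y)‖ ≤ (e₁ + e₂) * ‖y‖ := by
  have hQy : ‖Q y‖ ≤ ‖y‖ := norm_proj_le hQ y
  have he : 0 ≤ e₁ + e₂ := add_nonneg he₁ he₂
  refine ⟨?_, ?_, ?_⟩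
  · calc ‖T (Q y)‖ ≤ (e₁ + e₂) * ‖Q y‖ := hin (Q y) (cutLp_proj_eq_zero hC hQ y)
      _ ≤ (e₁ + e₂) * ‖y‖ := mul_le_mul_of_nonneg_left hQy he
  · have h1 : ‖y - cutLp L' y‖ ≤ ‖y‖ := by
      have h := norm_sub_cutLp_sq L' y
      have h0 : 0 ≤ ‖cutLp L' y‖ ^ 2 := sq_nonneg _
      have hle : ‖y - cutLp L' y‖ ^ 2 ≤ ‖y‖ ^ 2 := by linarith
      have := Real.sqrt_le_sqrt hle
      rwa [Real.sqrt_sq (norm_nonneg _), Real.sqrt_sq (norm_nonneg _)] at this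
    calc ‖Q (T y)‖ ≤ ‖T y - cutLp L (T y)‖ := norm_proj_le_norm_sub_cutLp hC hQ (T y)
      _ ≤ e₁ * ‖y - cutLp L' y‖ + e₂ * ‖y‖ := hout y
      _ ≤ e₁ * ‖y‖ + e₂ * ‖y‖ := by have := mul_le_mul_of_nonneg_left h1 he₁; linarith
      _ = (e₁ + e₂) * ‖y‖ := by ring
  · calc ‖ContinuousLinearMap.adjoint T (Q y)‖ ≤ (e₁ + e₂) * ‖Q y‖ := hinAdj (Q y) (cutLp_proj_eq_zero hC hQ y)
      _ ≤ (e₁ + e₂) * ‖y‖ := mul_le_mul_of_nonneg_left hQy he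

/-- The projector onto a class of two such projectors, `Q₁ + Q₂` (the `Q` of the window facts), inherits the characterisation with `C₁ ∪ C₂`. -/
theorem proj_add_char {C₁ C₂ : Set (Fin 3 → ℤ)} (h12 : ∀ k, k ∈ C₁ → k ∉ C₂) {Q₁ Q₂ : V2 →L[ℝ] V2}
    (hQ₁ : ∀ (y : V2) (k : Fin 3 → ℤ), mFourierCoeff (EuclideanSpace.complexify ∘ ⇑(Q₁ y)) k
        = if k ∈ C₁ then mFourierCoeff (EuclideanSpace.complexify ∘ ⇑y) k else 0)
    (hQ₂ : ∀ (y : V2) (k : Fin 3 → ℤ), mFourierCoeff (EuclideanSpace.complexify ∘ ⇑(Q₂ y)) k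
        = if k ∈ C₂ then mFourierCoeff (EuclideanSpace.complexify ∘ ⇑y) k else 0) :
    ∀ (y : V2) (k : Fin 3 → ℤ), mFourierCoeff (EuclideanSpace.complexify ∘ ⇑((Q₁ + Q₂) y)) k
        = if k ∈ C₁ ∪ C₂ then mFourierCoeff (EuclideanSpace.complexify ∘ ⇑y) k else 0 := by
  intro y k
  rw [show (Q₁ + Q₂) y = Q₁ y + Q₂ y from rfl, fcoeff_add, hQ₁, hQ₂]
  by_cases h1 : k ∈ C₁
  · simp [h1, h12 k h1]
  · by_cases h2 : k ∈ C₂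
    · simp [h1, h2]
    · simp [h1, h2]

end Summit.AnomalousDissipation.AnomalousDissipation.Theorems.SolenoidalFractalHomogenisation.LagrangianStep

end
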